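import Summits.Ventures.LatticeQCDFlow.Scaling.DoeblinHotSeparation

/-!
HONEST FRAMING: exact (Metropolis-corrected) sampling algorithms for lattice gauge theory; figures
of merit are autocorrelation/cost numbers at stated couplings and volumes; no continuum-physics
claim.

# DoeblinHotCostCeiling — COST ACCOUNTING WITH A DOEBLIN-MINORISED HOT SAMPLER: ONE RELAXATION TIME COSTS AT MOST
# `(2m/(cp))·(κ_s + ((1−t)/t)·κ_u)`, ONE AUTOCORRELATION TIME OF ANY OBSERVABLE AT MOST `(2m/(tcp) − ½)·(tκ_s + (1−t)κ_u)`
# ONCE `4t ≤ p(1−t)·a·w_0`; THE TUNED HOT-ONLY STAR (`m = cK`, `t = pa/(4+pa)`) PAYS AT MOST `2Kκ_s/p + 8Kκ_u/(p²a)` PER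
# AUTOCORRELATION TIME — THE HOT SAMPLER'S ACCEPTANCE FLOOR `a` DIVIDES THE HOT-DRAW BUDGET, NOT THE SWAP BUDGET
# (lean-2 GEN-27, ours)

Venture-side (OURS).  Cell `lqcd-flow` (pub-lqcd), unit `pub-lqcd-lean-2-g27`, 2026-08-27.  Doeblin-minorised hot
samplers, file 10 — `Scaling/DominatedStarCostCeiling` with the hot sampler of `Scaling/DoeblinHotSampler`
(`μ_k`-reversible single-site kernels, `M_0(u,·) ≥ a·μ_0(·)`, `0 < a ≤ 1`).  A swap step costs `κ_s` (one transport
evaluation and acceptance test), an update step `κ_u` (one proposal of the hot sampler, e.g. one flow draw with its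
Metropolis test); the mean cost of a step of `P = t·GSw + (1−t)·Π_w^M` is `tκ_s + (1−t)κ_u`.

## What is proved

* **`doeblinStar_relaxationCost_le`** — `(tκ_s + (1−t)κ_u)·t_rel ≤ (2m/(cp))·(κ_s + ((1−t)/t)·κ_u)`.
* **`doeblinStar_autocorrelationCost_le`** (`|S| ≥ 2`) — `τ_int(g)·(tκ_s + (1−t)κ_u) ≤ (1/(tcp/(2m)) − ½)·(tκ_s + (1−t)κ_u)`.
* **`doeblinTunedStar_autocorrelationCost_le`** — hot-only updates, `m = cK`, `t = pa/(4+pa)`: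
  **`τ_int(g)·(tκ_s + (1−t)κ_u) ≤ 2Kκ_s/p + 8Kκ_u/(p²a)`** for every observable `g`.

Reading (no numerics implied): per effectively independent sample the exact tempering hub with a learned transport of
one-sided quality `p` and a Metropolised-flow hot level of acceptance floor `a` needs at most order `K/p` transport
tests plus order `K/(p²a)` hot proposals at uniform listing — against `Scaling/DominatedStarCostCeiling`'s
`2Kκ_s/p + 8Kκ_u/p²` for the exact hot sampler: the flow's imperfection is paid in hot draws only.  NOT CLAIMED:
amortised training costs; that `1/(p²a)` is necessary (it enters through the conservative regime); anything measured.
Literature grade (cell rule): OWN COMPOSITION (arithmetic on `Scaling/DoeblinHotSeparation` ∕ `DoeblinHotGapAndMixing`);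
nothing cited as a fact; no new bib keys.
-/

noncomputable section

open Finset Function
open Literature.Probability.MarkovChains

namespace Summit.Ventures.LatticeQCDFlow.Scaling

variable {S : Type*} [Fintype S] [DecidableEq S] {K m : ℕ} {μ : Fin (K + 1) → S → ℝ} {M : Fin (K + 1) → S → S → ℝ}
  {w : Fin (K + 1) → ℝ} {t p a : ℝ}

section Cost
variable (κ : Fin m → Fin K) (φ : Fin m → Equiv.Perm S)

/-- **THE COST OF ONE RELAXATION TIME WITH A DOEBLIN-MINORISED HOT SAMPLER:
`(tκ_s + (1−t)κ_u)·t_rel ≤ (2m/(cp))·(κ_s + ((1−t)/t)·κ_u)`** (`0 < t`, `4t ≤ p(1−t)·a·w_0`, `κ_s, κ_u ≥ 0`). [ours] -/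
theorem doeblinStar_relaxationCost_le (hm : 1 ≤ m) (ht0 : 0 < t) (ht1 : t ≤ 1) (hw0 : ∀ k, 0 ≤ w k)
    (hw1 : ∑ k, w k = 1) (hμ : ∀ k x, 0 < μ k x) (hμ1 : ∀ k, ∑ u, μ k u = 1) (hM : ∀ k, IsRowStochastic (M k))
    (hMrev : ∀ k, DetailedBalance (μ k) (M k)) (ha0 : 0 < a) (ha1 : a ≤ 1) (hmin : ∀ u v, a * μ 0 v ≤ M 0 u v)
    (hp0 : 0 < p) (hp1 : p ≤ 1) (hdom : ∀ r u, p * μ (κ r).succ (φ r u) ≤ μ 0 u)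
    (hreg : 4 * t ≤ p * (1 - t) * (a * w 0))
    {c : ℕ} (hc1 : 1 ≤ c) (hc : ∀ p' : Fin K, c ≤ (univ.filter (fun r : Fin m => κ r = p')).card) (hcm : c ≤ m)
    {κs κu : ℝ} (hκs : 0 ≤ κs) (hκu : 0 ≤ κu) :
    (t * κs + (1 - t) * κu) * relaxationTime (fun y z : Fin (K + 1) → S =>
        t * ptGraphSwap μ (fun r : Fin m => (((0 : Fin (K + 1)), (κ r).succ) : Fin (K + 1) × Fin (K + 1))) φ y z
          + (1 - t) * prodKernel w M y z)
      ≤ 2 * m / (c * p) * (κs + (1 - t) / t * κu) := by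
  have hmpos : (0 : ℝ) < m := Nat.cast_pos.mpr (by omega)
  have hcpos : (0 : ℝ) < c := Nat.cast_pos.mpr (by omega)
  have hrel := doeblinStar_relaxationTime_le κ φ hm ht0 ht1 hw0 hw1 hμ hμ1 hM hMrev ha0 ha1 hmin hp0 hp1 hdom hreg hc1 hc
    hcm
  have hcost : 0 ≤ t * κs + (1 - t) * κu := by nlinarith
  calc (t * κs + (1 - t) * κu) * relaxationTime _ ≤ (t * κs + (1 - t) * κu) * (2 * m / (t * c * p)) :=
        mul_le_mul_of_nonneg_left hrel hcost
    _ = 2 * m / (c * p) * (κs + (1 - t) / t * κu) := by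
        field_simp

/-- **THE COST OF ONE AUTOCORRELATION TIME OF ANY OBSERVABLE WITH A DOEBLIN-MINORISED HOT SAMPLER:**
`τ_int(g)·(tκ_s + (1−t)κ_u) ≤ (1/(tcp/(2m)) − ½)·(tκ_s + (1−t)κ_u)` (`|S| ≥ 2`). [ours] -/
theorem doeblinStar_autocorrelationCost_le [Nontrivial S] (hm : 1 ≤ m) (ht0 : 0 < t) (ht1 : t ≤ 1) (hw0 : ∀ k, 0 ≤ w k)
    (hw1 : ∑ k, w k = 1) (hμ : ∀ k x, 0 < μ k x) (hμ1 : ∀ k, ∑ u, μ k u = 1) (hM : ∀ k, IsRowStochastic (M k))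
    (hMrev : ∀ k, DetailedBalance (μ k) (M k)) (ha0 : 0 < a) (ha1 : a ≤ 1) (hmin : ∀ u v, a * μ 0 v ≤ M 0 u v)
    (hp0 : 0 < p) (hp1 : p ≤ 1) (hdom : ∀ r u, p * μ (κ r).succ (φ r u) ≤ μ 0 u)
    (hreg : 4 * t ≤ p * (1 - t) * (a * w 0))
    {c : ℕ} (hc1 : 1 ≤ c) (hc : ∀ p' : Fin K, c ≤ (univ.filter (fun r : Fin m => κ r = p')).card) (hcm : c ≤ m)
    {κs κu : ℝ} (hκs : 0 ≤ κs) (hκu : 0 ≤ κu) (g : (Fin (K + 1) → S) → ℝ) :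
    asympVar g (tensorFun μ) (fun y z : Fin (K + 1) → S =>
        t * ptGraphSwap μ (fun r : Fin m => (((0 : Fin (K + 1)), (κ r).succ) : Fin (K + 1) × Fin (K + 1))) φ y z
          + (1 - t) * prodKernel w M y z) / (2 * lawVariance (tensorFun μ) g) * (t * κs + (1 - t) * κu)
      ≤ (1 / (t * c * p / (2 * m)) - 1 / 2) * (t * κs + (1 - t) * κu) := by
  have hcost : 0 ≤ t * κs + (1 - t) * κu := by nlinarith
  exact mul_le_mul_of_nonneg_right (doeblinStar_tauInt_le κ φ hm ht0 ht1 hw0 hw1 hμ hμ1 hM hMrev ha0 ha1 hmin hp0 hp1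
    hdom hreg hc1 hc hcm g) hcost

/-- **THE TUNED HOT-ONLY STAR WITH A DOEBLIN-MINORISED HOT SAMPLER (`m = cK`, `t = pa/(4+pa)`):
`τ_int(g)·(tκ_s + (1−t)κ_u) ≤ 2Kκ_s/p + 8Kκ_u/(p²a)`** for every observable `g` (`|S| ≥ 2`, `K ≥ 1`, reversible kernels,
one-sided domination). [ours] -/
theorem doeblinTunedStar_autocorrelationCost_le [Nontrivial S] (hK : 1 ≤ K) (hμ : ∀ k x, 0 < μ k x)
    (hμ1 : ∀ k, ∑ u, μ k u = 1) (hM : ∀ k, IsRowStochastic (M k)) (hMrev : ∀ k, DetailedBalance (μ k) (M k))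
    (ha0 : 0 < a) (ha1 : a ≤ 1) (hmin : ∀ u v, a * μ 0 v ≤ M 0 u v) (hp0 : 0 < p) (hp1 : p ≤ 1)
    (hdom : ∀ r u, p * μ (κ r).succ (φ r u) ≤ μ 0 u) {c : ℕ} (hc1 : 1 ≤ c)
    (hc : ∀ p' : Fin K, c ≤ (univ.filter (fun r : Fin m => κ r = p')).card) (hmc : m = c * K)
    {κs κu : ℝ} (hκs : 0 ≤ κs) (hκu : 0 ≤ κu) (g : (Fin (K + 1) → S) → ℝ) :
    asympVar g (tensorFun μ) (fun y z : Fin (K + 1) → S =>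
        p * a / (4 + p * a)
            * ptGraphSwap μ (fun r : Fin m => (((0 : Fin (K + 1)), (κ r).succ) : Fin (K + 1) × Fin (K + 1))) φ y z
          + (1 - p * a / (4 + p * a)) * prodKernel (fun k : Fin (K + 1) => if k = 0 then (1 : ℝ) else 0) M y z)
        / (2 * lawVariance (tensorFun μ) g) * (p * a / (4 + p * a) * κs + (1 - p * a / (4 + p * a)) * κu)
      ≤ 2 * K * κs / p + 8 * K * κu / (p ^ 2 * a) := by
  have hm : 1 ≤ m := by rw [hmc]; exact Nat.one_le_iff_ne_zero.mpr (Nat.mul_ne_zero (by omega) (by omega))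
  have hcm : c ≤ m := by rw [hmc]; exact Nat.le_mul_of_pos_right c (by omega)
  have hw0 : ∀ k : Fin (K + 1), 0 ≤ (if k = 0 then (1 : ℝ) else 0) := fun k => by split_ifs <;> norm_num
  have hw1 : ∑ k : Fin (K + 1), (if k = 0 then (1 : ℝ) else 0) = 1 := by
    rw [Finset.sum_ite_eq' univ (0 : Fin (K + 1)), if_pos (mem_univ _)]
  have hpa : 0 < p * a := mul_pos hp0 ha0
  have h4p : 0 < 4 + p * a := by linarith
  have ht0 : 0 < p * a / (4 + p * a) := div_pos hpa h4p
  have ht1 : p * a / (4 + p * a) ≤ 1 := by rw [div_le_one h4p]; linarith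
  have hreg : 4 * (p * a / (4 + p * a))
      ≤ p * (1 - p * a / (4 + p * a)) * (a * (if (0 : Fin (K + 1)) = 0 then (1 : ℝ) else 0)) := by
    rw [if_pos rfl, mul_one]
    have e : p * (1 - p * a / (4 + p * a)) * a = 4 * (p * a / (4 + p * a)) := by field_simp; ring
    rw [e]
  have h := doeblinStar_autocorrelationCost_le κ φ hm ht0 ht1 hw0 hw1 hμ hμ1 hM hMrev ha0 ha1 hmin hp0 hp1 hdom hreg hc1
    hc hcm hκs hκu g
  refine h.trans ?_
  have hcpos : (0 : ℝ) < c := Nat.cast_pos.mpr (by omega)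
  have hKpos : (0 : ℝ) < K := Nat.cast_pos.mpr (by omega)
  have hmR : (m : ℝ) = c * K := by rw [hmc, Nat.cast_mul]
  -- `1/(tcp/(2m)) = 2K(4+pa)/(p²a)` and `tκ_s + (1−t)κ_u = (paκ_s + 4κ_u)/(4+pa)`
  have e1 : 1 / (p * a / (4 + p * a) * c * p / (2 * (m : ℝ))) = 2 * K * (4 + p * a) / (p ^ 2 * a) := by
    rw [hmR]; field_simp
  have e2 : p * a / (4 + p * a) * κs + (1 - p * a / (4 + p * a)) * κu = (p * a * κs + 4 * κu) / (4 + p * a) := by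
    field_simp; ring
  rw [e1, e2]
  have hnum : 0 ≤ p * a * κs + 4 * κu := by positivity
  calc (2 * K * (4 + p * a) / (p ^ 2 * a) - 1 / 2) * ((p * a * κs + 4 * κu) / (4 + p * a))
      ≤ 2 * K * (4 + p * a) / (p ^ 2 * a) * ((p * a * κs + 4 * κu) / (4 + p * a)) := by
        refine mul_le_mul_of_nonneg_right (by linarith) (div_nonneg hnum h4p.le)
    _ = 2 * K * κs / p + 8 * K * κu / (p ^ 2 * a) := by
        field_simp
        ring

end Cost

end Summit.Ventures.LatticeQCDFlow.Scaling

end
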